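import Literature.AlgebraicGeometry.Resolution.CentreBlowupThm36Permissible
import HarnessLib

/-!
# [CP19] Theorem 3.6, the `ω`-half: `ω(x') ≤ ω(x)` under the blow-up of a permissible coordinate
  centre OF THE FIRST KIND, in the model — and `NoOmegaIncreaseAtCentre` for every permissible centre

Topic: `Literature/AlgebraicGeometry/Resolution`.  Cell `pub-rosobs` (resolution observatory), unit
`pub-rosobs-carver-g26`.  Companion of `CentreBlowupThm36FirstKind.lean` (the `ε`-clauses of
Thm. 3.6 (1) at first-kind centres), `CentreBlowupThm36SecondKind.lean` (second kind: neither `ε` nor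
`ω` increases) and `CentreBlowupThm36Permissible.lean`, whose docstrings record the one gap this file
closes: "The first-kind half of the `ω`-monotonicity is not proved in the tree."

* V. Cossart, O. Piltant, *Resolution of singularities of arithmetical threefolds*, J. Algebra **529**
  (2019) 268–535, arXiv:1412.0868 — ch. 3 "Permissible blowing ups", Theorem 3.6 (PDF p. 35):
  "Let `π : 𝒳' → 𝒳` be the blowing up along a permissible center `𝒴` (of the first kind or second
  kind) at `x`, `x' ∈ π⁻¹(x)` … Then `(m(x'), ω(x'), κ(x')) ≤ (m(x), ω(x), κ(x))`", and its proof
  (PDF pp. 36–38): the transform `I' ⊇ (U^{-ε}J(F_{p,Z},E,m_S))'` of the Jacobian module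
  `J(F,E,m_S) = H⁻¹⟨U_j ∂F/∂U_j (j ∈ E), ∂F/∂U_j (j ∉ E)⟩` (Def. 2.15–2.16, PDF p. 24) bounds `ε(x')`,
  and the "claim" `ε(x') = 1 + ord I' ⟹ V(F'_{p,Z'},E') ≠ 0`.

## What is proved (the cell's coordinate-centre model `CentreBlowup.CState / step`, `E = exc`)

For a state `s = (F, r, exc)` with CLEAN residual polynomial (`deletePthPowers p F = F`), a centre
`C_S` permissible of the first kind (`IsFirstKind p S s`: `p ≤ ord_{C_S} F` and `ε(y) = ε(x)`), a chart
`j ∈ S` and a point `b` of the fibre over `x` (`b_j = 0`, `b = 0` off `S`):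

* `CState.omega_step_le_of_isFirstKind` — **`ω(x') ≤ ω(x)`**; `CState.not_omegaIncreases_of_isFirstKind`;
* `CState.not_omegaIncreases_of_isPermissibleCentre` — first OR second kind (the second-kind half is
  `SecondKind.not_omegaIncreases_of_isSecondKind`);
* `CState.noOmegaIncreaseAtCentre` — **the atlas predicate `NoOmegaIncreaseAtCentre p S j b s` of
  `CentreBlowupAdaptedOrder.lean` holds for every `S, j, b` and every clean state `s`** (its hypotheses
  `IsEquimultiplePoint`, `0 < ω(x) < ⊤` are not used), and `CState.noOmegaIncreaseAtCentre_step` — hence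
  unconditionally at every state produced by a step of the walk (steps clean their output);
* `CState.noOmegaIncreaseAt_point` — the point atlas's row-wise test predicate
  `PointBlowup.NoOmegaIncreaseAt p j b E s` (`PointBlowupAdaptedOrder.lean`) at every `p`-fold point
  (`p ≤ ord₀ F`, so that `{x}` is a first-kind centre, `isFirstKind_univ`) with clean `F`, every boundary
  `E` and every point `b` of the exceptional divisor of the chart (`b_j = 0`), via `omegaIncreases_univ_iff`.

Mechanism (the model form of CP's transform of the Jacobian module, PDF pp. 36–37): write
`G = translate_b (chartTransform F)` for the transform before cleaning and `T` for the termwise map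
`y^d ↦ y_j^{deg_S d − p} ∏_{i∈S∖j}(y_i + b_i)^{d_i} y_N^{d_N}`.  Then, monomial by monomial,
`T(U_i ∂F/∂U_i) = (U_i + b_i) ∂G/∂U_i` (`i ≠ j`) and, the new `y_j`-exponent `deg_S d − p` being
congruent to `deg_S d` modulo the characteristic, `U_j ∂G/∂U_j = T(D_S F)` with
`D_S = Σ_{i∈S} U_i∂/∂U_i`, so that `T(U_j ∂F/∂U_j) = U_j ∂G/∂U_j − Σ_{i∈S∖j}(U_i + b_i)∂G/∂U_i` (Euler).  At a first-kind centre every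
initial monomial has `deg_S = ord_{C_S}F =: k` (Prop. 3.1, tree `CentreBlowupProp31`), so the image under
`T` of the initial part of `U_l∂F/∂U_l` is separated from the rest by the pair (`y_j`-exponent `k − p`,
`Σ_{u∉S}`-degree `ord₀F − k`) and survives translation with a monomial of degree
`≤ |r'| + ε(x)` (`≤ |r'| + ε(x) − 1` for a `V`-witness `l ∉ E`), `r'` the new record of the auxiliary
Moh state `(F, H|_E)`; reading that monomial off `U_j∂G/∂U_j`, `U_i∂G/∂U_i` or `∂G/∂U_i` (`b_i ≠ 0`:
a variable that is NOT in `E'`) gives either `ord₀ F' ≤ |r'| + ω(x)` or a `V`-witness of `F'` in degree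
`≤ |r'| + ω(x) + 1`, whence `ω(x') ≤ ω(x)`.

Cleanliness is necessary in the model: for `p = 2`, `F = y₂² + y₂⁷` (not clean), `S = {1,2}`,
`E = ∅`, chart `y₁`, `b = 0` one finds `ω(x) = 2 < ω(x') = 6` (cell evidence `omega_search_unclean.py`:
152 such cases with `deg F ≤ 7`, all with an initial form made of `p`-th powers; 0 cases among
4.9·10⁶ clean first-kind blow-ups).

## Scope (what this is NOT)

Statements about the cell's combinatorial model only: fixed coordinates (no re-choice of well adapted
coordinates after the step), `G = 0` (`i₀ = p`), a perfect-field reading of `V` and of the cleaning,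
points `b` of the chart with `b = 0` off `S`.  `κ` and assertion (2) of Thm. 3.6 are not modelled.  The
citation tags name the printed statements these model theorems read; they do not claim a formalisation
of [CP19]'s theorem for arithmetical threefolds.  AI-assisted formalisation (observatory `pub-rosobs`).
-/

noncomputable section

open MvPolynomial Finset

open scoped BigOperators

namespace Literature.AlgebraicGeometry.Resolution

open Literature.AlgebraicGeometry.Resolution.Hauser2010
open Literature.AlgebraicGeometry.Resolution.HauserPerlega2019 (initialForm)
open Literature.Barriers.ResolutionOfSingularities

namespace CentreBlowup

/-! ### 0. Private helpers (numbers of a residual polynomial) -/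

section Helpers

variable {σ : Type*} {K : Type*} [Field K]

/-- evaluation of `bigHVec`. [folklore] -/
private theorem bigHVec_apply' [DecidableEq σ] (E : Finset σ) (F : MvPolynomial σ K) (i : σ) :
    PointBlowup.bigHVec E F i = if i ∈ E then (PointBlowup.bigH F i).toNat else 0 := by
  unfold PointBlowup.bigHVec
  rw [Finsupp.finsetSum_apply]
  by_cases hi : i ∈ E
  · rw [if_pos hi, Finset.sum_eq_single_of_mem i hi (fun j _ hji => by
      rw [Finsupp.single_apply, if_neg hji])]
    exact Finsupp.single_eq_same
  · rw [if_neg hi]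
    exact Finset.sum_eq_zero fun j hj => by
      have hji : j ≠ i := fun h => hi (h ▸ hj)
      rw [Finsupp.single_apply, if_neg hji]

/-- `H_i ≤ d_i` for every monomial `y^d` of `F`. [folklore] -/
private theorem bigH_le' {F : MvPolynomial σ K} {d : σ →₀ ℕ} (hd : d ∈ F.support) (i : σ) :
    PointBlowup.bigH F i ≤ d i :=
  Finset.inf_le (f := fun d : σ →₀ ℕ => ((d i : ℕ) : ℕ∞)) hd

/-- For `F ≠ 0`, `H_i` is finite. [folklore] -/
private theorem bigH_eq_toNat' {F : MvPolynomial σ K} (hF : F ≠ 0) (i : σ) :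
    PointBlowup.bigH F i = (((PointBlowup.bigH F i).toNat : ℕ) : ℕ∞) := by
  obtain ⟨d, -, h⟩ := Finset.exists_mem_eq_inf F.support (MvPolynomial.support_nonempty.mpr hF)
    (fun d : σ →₀ ℕ => ((d i : ℕ) : ℕ∞))
  rw [show PointBlowup.bigH F i = ((d i : ℕ) : ℕ∞) from h]
  rfl

/-- For `F ≠ 0`, `ord₀ F` is finite. [folklore] -/
private theorem exists_ordZero_eq' {F : MvPolynomial σ K} (hF : F ≠ 0) : ∃ o : ℕ, ordZero F = o := by
  have hne : ordZero F ≠ ⊤ := by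
    unfold ordZero
    rw [Ne, MvPowerSeries.order_eq_top_iff, MvPolynomial.coe_eq_zero_iff]
    exact hF
  exact ⟨(ordZero F).toNat, (ENat.coe_toNat hne).symm⟩

/-- A finite order means a non-zero polynomial. [folklore] -/
private theorem ne_zero_of_ordZero_eq' {F : MvPolynomial σ K} {o : ℕ} (ho : ordZero F = o) : F ≠ 0 := by
  intro h
  rw [h, ordZero_zero] at ho
  exact ENat.top_ne_coe _ ho

/-- `y^{H|_E} ∣ F` monomialwise. [folklore] -/
private theorem bigHVec_le' [DecidableEq σ] (E : Finset σ) (F : MvPolynomial σ K) :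
    ∀ d ∈ F.support, PointBlowup.bigHVec E F ≤ d := by
  intro d hd
  have hF : F ≠ 0 := MvPolynomial.ne_zero_iff.mpr ⟨d, MvPolynomial.mem_support_iff.mp hd⟩
  rw [Finsupp.le_def]
  intro i
  rw [bigHVec_apply']
  split_ifs with hi
  · have h := bigH_le' hd i
    rw [bigH_eq_toNat' hF] at h
    exact_mod_cast h
  · exact Nat.zero_le _

/-- `Σ_{i ∈ E} H_i = |H|_E|` for `F ≠ 0`. [folklore] -/
private theorem sum_bigH_eq' [DecidableEq σ] {F : MvPolynomial σ K} (hF : F ≠ 0) (E : Finset σ) :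
    ∑ j ∈ E, PointBlowup.bigH F j = (((PointBlowup.bigHVec E F).degree : ℕ) : ℕ∞) := by
  unfold PointBlowup.bigHVec
  rw [map_sum, Nat.cast_sum]
  exact Finset.sum_congr rfl fun j _ => by
    rw [Finsupp.degree_single]
    exact bigH_eq_toNat' hF j

/-- `ε(x) = ord₀ F − |H|_exc|` in `ℕ` for `F ≠ 0` of order `o`. [folklore] -/
private theorem epsilon_eq_natCast' [DecidableEq σ] (s : CState σ K) {o : ℕ} (ho : ordZero s.F = o) :
    s.epsilon = ((o - (PointBlowup.bigHVec s.exc s.F).degree : ℕ) : ℕ∞) := by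
  rw [CState.epsilon_eq, sum_bigH_eq' (ne_zero_of_ordZero_eq' ho), ho, ← ENat.coe_sub]

/-- `y_i ∂_i (c y^e) = e_i c y^e`. [folklore] -/
private theorem X_mul_pderiv_monomial' (i : σ) (e : σ →₀ ℕ) (c : K) :
    X i * pderiv i (monomial e c) = monomial e (((e i : ℕ) : K) * c) := by
  rw [X_mul_pderiv_monomial, ← Nat.cast_smul_eq_nsmul K, smul_monomial, smul_eq_mul]

/-- The centre chart exponent off the chart variable. [folklore] -/
private theorem chartExponent_apply_of_ne' [DecidableEq σ] (q : ℕ) (S : Finset σ) {j i : σ}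
    (hij : i ≠ j) (d : σ →₀ ℕ) : chartExponent q S j d i = d i := by
  unfold chartExponent
  rw [Finsupp.update_apply, if_neg hij]

/-- The centre chart exponent at the chart variable. [folklore] -/
private theorem chartExponent_apply_self' [DecidableEq σ] (q : ℕ) (S : Finset σ) (j : σ)
    (d : σ →₀ ℕ) : chartExponent q S j d j = degIn S d - q := by
  unfold chartExponent
  rw [Finsupp.update_apply, if_pos rfl]

/-- Degree of the centre chart exponent: `|d^S| + d_j = |d| + (deg_S d − q)`. [folklore] -/
private theorem degree_chartExponent_add' [Fintype σ] [DecidableEq σ] (q : ℕ) (S : Finset σ) (j : σ)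
    (d : σ →₀ ℕ) : (chartExponent q S j d).degree + d j = d.degree + (degIn S d - q) := by
  unfold chartExponent
  exact PointBlowup.degree_update_add d j _

/-- The centre chart exponent is injective on exponents with `deg_S ≥ q`. [folklore] -/
private theorem eq_of_chartExponent_eq' [Fintype σ] [DecidableEq σ] {q : ℕ} {S : Finset σ} {j : σ}
    (hj : j ∈ S) {d d' : σ →₀ ℕ} (hd : q ≤ degIn S d) (hd' : q ≤ degIn S d')
    (h : chartExponent q S j d = chartExponent q S j d') : d = d' := by
  have hne : ∀ i, i ≠ j → d i = d' i := fun i hi => by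
    have := DFunLike.congr_fun h i
    rwa [chartExponent_apply_of_ne' q S hi, chartExponent_apply_of_ne' q S hi] at this
  have hjj : degIn S d - q = degIn S d' - q := by
    have := DFunLike.congr_fun h j
    rwa [chartExponent_apply_self', chartExponent_apply_self'] at this
  have hsum : ∑ i ∈ S.erase j, d i = ∑ i ∈ S.erase j, d' i :=
    Finset.sum_congr rfl fun i hi => hne i (Finset.ne_of_mem_erase hi)
  have h1 : d j + ∑ i ∈ S.erase j, d i = degIn S d := Finset.add_sum_erase S (⇑d) hj
  have h2 : d' j + ∑ i ∈ S.erase j, d' i = degIn S d' := Finset.add_sum_erase S (⇑d') hj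
  ext i
  by_cases hij : i = j
  · subst hij; omega
  · exact hne i hij

end Helpers

/-! ### 1. Transport of the Jacobian module through one `C_S`-step (before cleaning) -/

section Transport

variable {σ : Type*} {K : Type*} [Field K] [Fintype σ] [DecidableEq σ]
variable (p : ℕ) [hp : Fact p.Prime] [CharP K p]

omit [Fintype σ] hp [CharP K p] in
/-- `T(U_i ∂F/∂U_i) = (U_i + b_i) ∂G/∂U_i` for `i ≠ j`, `G` the translated chart transform.
[folklore] -/
private theorem transport_log_ne' (q : ℕ) (S : Finset σ) {j i : σ} (hij : i ≠ j) (b : σ → K)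
    (F : MvPolynomial σ K) :
    (X i + C (b i)) * pderiv i (PointBlowup.translate b (chartTransform q S j F)) =
      PointBlowup.translate b
        (∑ d ∈ F.support, monomial (chartExponent q S j d) (((d i : ℕ) : K) * coeff d F)) := by
  unfold chartTransform
  rw [PointBlowup.translate_finset_sum, PointBlowup.translate_finset_sum, map_sum (pderiv i),
    Finset.mul_sum]
  refine Finset.sum_congr rfl fun d _ => ?_
  rw [PointBlowup.pderiv_translate, ← PointBlowup.translate_X_mul, X_mul_pderiv_monomial',
    chartExponent_apply_of_ne' q S hij]

omit [Fintype σ] hp in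
/-- `U_j ∂G/∂U_j = T(D_S F)`, `D_S = Σ_{i∈S} U_i ∂/∂U_i`, in characteristic `p` (`b_j = 0`,
`deg_S ≥ p` on the monomials of `F`). [folklore] -/
private theorem transport_log_self' (S : Finset σ) (j : σ) (b : σ → K) (hbj : b j = 0)
    (F : MvPolynomial σ K) (hq : ∀ d ∈ F.support, p ≤ degIn S d) :
    X j * pderiv j (PointBlowup.translate b (chartTransform p S j F)) =
      PointBlowup.translate b
        (∑ d ∈ F.support, monomial (chartExponent p S j d) (((degIn S d : ℕ) : K) * coeff d F)) := by
  unfold chartTransform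
  rw [PointBlowup.translate_finset_sum, PointBlowup.translate_finset_sum, map_sum (pderiv j),
    Finset.mul_sum]
  refine Finset.sum_congr rfl fun d hd => ?_
  have hX : (X j : MvPolynomial σ K) = X j + C (b j) := by rw [hbj, C_0, add_zero]
  rw [PointBlowup.pderiv_translate, hX, ← PointBlowup.translate_X_mul, X_mul_pderiv_monomial',
    chartExponent_apply_self', Nat.cast_sub (hq d hd), CharP.cast_eq_zero K p, sub_zero]

omit [Fintype σ] hp in
/-- **Euler transport**: `T(U_j ∂F/∂U_j) = U_j ∂G/∂U_j − Σ_{i ∈ S∖j} (U_i + b_i) ∂G/∂U_i`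
(`j ∈ S`, `b_j = 0`, `deg_S ≥ p` on the monomials of `F`, characteristic `p`). [folklore] -/
private theorem transport_euler' (S : Finset σ) {j : σ} (hj : j ∈ S) (b : σ → K) (hbj : b j = 0)
    (F : MvPolynomial σ K) (hq : ∀ d ∈ F.support, p ≤ degIn S d) :
    PointBlowup.translate b
        (∑ d ∈ F.support, monomial (chartExponent p S j d) (((d j : ℕ) : K) * coeff d F)) =
      X j * pderiv j (PointBlowup.translate b (chartTransform p S j F)) -
        ∑ i ∈ S.erase j, (X i + C (b i)) * pderiv i (PointBlowup.translate b (chartTransform p S j F)) := by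
  rw [transport_log_self' p S j b hbj F hq]
  have hi : ∀ i ∈ S.erase j, (X i + C (b i)) * pderiv i (PointBlowup.translate b (chartTransform p S j F)) =
      PointBlowup.translate b
        (∑ d ∈ F.support, monomial (chartExponent p S j d) (((d i : ℕ) : K) * coeff d F)) :=
    fun i hi => transport_log_ne' p S (Finset.ne_of_mem_erase hi) b F
  rw [Finset.sum_congr rfl hi, ← PointBlowup.translate_finset_sum, ← PointBlowup.translate_sub]
  congr 1
  rw [Finset.sum_comm, ← Finset.sum_sub_distrib]
  refine Finset.sum_congr rfl fun d _ => ?_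
  rw [← map_sum, ← map_sub]
  congr 1
  rw [← Finset.sum_mul, ← sub_mul]
  congr 1
  have h := Finset.add_sum_erase S (fun i => d i) hj
  have h' : ((degIn S d : ℕ) : K) = ((d j : ℕ) : K) + ∑ i ∈ S.erase j, ((d i : ℕ) : K) := by
    rw [← Nat.cast_sum, ← Nat.cast_add]
    exact congrArg _ (by unfold degIn; exact h.symm)
  rw [h']
  ring

end Transport

/-! ### 2. The low monomial of the transported initial module -/

section LowMonomial

variable {σ : Type*} {K : Type*} [Field K] [Fintype σ] [DecidableEq σ] [DecidableEq K]
variable (p : ℕ) [hp : Fact p.Prime] [CharP K p]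

omit hp [CharP K p] in
/-- **The low monomial.**  Let every monomial `y^d` of `F` have `|d| ≥ o` and `deg_S d ≥ k ≥ p`, and
let the initial ones (`|d| = o`) have `deg_S d = k`.  For a weight `w` not killing all initial monomials,
a vector `ρ` with `ρ_j = k − p` lying below the chart exponents of the weighted initial monomials, which
have degree `≤ |ρ| + D`: the translate of the weighted chart transform `Σ_d w(d) c_d y^{d^S}` has a
monomial of degree `≤ |ρ|_{b = 0}| + D` (the part coming from the non-initial monomials lives at other
(`y_j`-exponent, `Σ_{u∉S}`-degree) and cannot cancel it). [folklore] -/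
private theorem exists_low_monomial' (S : Finset σ) {j : σ} (hj : j ∈ S) (b : σ → K) (hbj : b j = 0)
    (hbN : ∀ i, i ∉ S → b i = 0) (F : MvPolynomial σ K) {o k : ℕ} (hkp : p ≤ k)
    (hdeg : ∀ d ∈ F.support, o ≤ d.degree) (hdegIn : ∀ d ∈ F.support, k ≤ degIn S d)
    (hinit : ∀ d ∈ F.support, d.degree = o → degIn S d = k) (w : (σ →₀ ℕ) → K) (ρ : σ →₀ ℕ)
    (hρj : ρ j = k - p) (D : ℕ)
    (hρ : ∀ d ∈ F.support, d.degree = o → w d * coeff d F ≠ 0 →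
      ρ ≤ chartExponent p S j d ∧ (chartExponent p S j d).degree ≤ ρ.degree + D)
    (hex : ∃ d ∈ F.support, d.degree = o ∧ w d * coeff d F ≠ 0) :
    ∃ ν : σ →₀ ℕ, coeff ν (PointBlowup.translate b
        (∑ d ∈ F.support, monomial (chartExponent p S j d) (w d * coeff d F))) ≠ 0 ∧
      ν.degree ≤ (ρ.filter fun i => b i = 0).degree + D := by
  -- the initial part `Pc` and the rest `Pr`
  set T : Finset (σ →₀ ℕ) := F.support.filter (fun d => d.degree = o) with hT
  set Pc : MvPolynomial σ K := ∑ d ∈ T, monomial (chartExponent p S j d) (w d * coeff d F) with hPc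
  set Pr : MvPolynomial σ K := ∑ d ∈ F.support.filter (fun d => ¬ d.degree = o),
    monomial (chartExponent p S j d) (w d * coeff d F) with hPr
  have hsplit : (∑ d ∈ F.support, monomial (chartExponent p S j d) (w d * coeff d F)) = Pc + Pr := by
    rw [hPc, hPr, hT, Finset.sum_filter_add_sum_filter_not]
  have hmemT : ∀ d ∈ T, d ∈ F.support ∧ d.degree = o := fun d hd => Finset.mem_filter.mp hd
  have hko : k ≤ o := by
    obtain ⟨d₀, hd₀, hd₀o, -⟩ := hex
    have h1 := hinit d₀ hd₀ hd₀o
    have h2 := degIn_le_degree S d₀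
    omega
  -- supports of `Pc`
  have hsuppPc : ∀ e ∈ Pc.support, ∃ d ∈ T, w d * coeff d F ≠ 0 ∧ chartExponent p S j d = e :=
    fun e he => PointBlowup.exists_of_mem_support_sum_monomial T _ _ he
  -- the layer lemma
  have hρ' : ∀ e ∈ Pc.support, ρ ≤ e := by
    intro e he
    obtain ⟨d, hd, hw, rfl⟩ := hsuppPc e he
    exact (hρ d (hmemT d hd).1 (hmemT d hd).2 hw).1
  have hD' : ∀ e ∈ Pc.support, e j = ρ j → e.degree ≤ ρ.degree + D := by
    intro e he _
    obtain ⟨d, hd, hw, rfl⟩ := hsuppPc e he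
    exact (hρ d (hmemT d hd).1 (hmemT d hd).2 hw).2
  have hlayer : ∃ e ∈ Pc.support, e j = ρ j := by
    obtain ⟨d₀, hd₀, hd₀o, hw₀⟩ := hex
    have hd₀T : d₀ ∈ T := Finset.mem_filter.mpr ⟨hd₀, hd₀o⟩
    refine ⟨chartExponent p S j d₀, ?_, ?_⟩
    · rw [MvPolynomial.mem_support_iff, hPc,
        PointBlowup.coeff_sum_monomial_of_injOn T (fun d => chartExponent p S j d)
          (fun d => w d * coeff d F) hd₀T]
      · exact hw₀
      · intro d hd _ h
        exact eq_of_chartExponent_eq' hj (le_trans hkp (hdegIn d (hmemT d hd).1))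
          (le_trans hkp (hdegIn d₀ hd₀)) h
    · rw [chartExponent_apply_self', hinit d₀ hd₀ hd₀o, hρj]
  obtain ⟨ν, hν, hνj, hνdeg⟩ :=
    PointBlowup.exists_mem_support_translate_layer b hbj Pc ρ hρ' D hD' hlayer
  refine ⟨ν, ?_, hνdeg⟩
  -- `ν` records the `Σ_{u ∉ S}`-degree `o − k` of the initial monomials
  have hνN : ∑ u ∈ Sᶜ, ν u = o - k := by
    have h := MvPolynomial.mem_support_iff.mp hν
    rw [hPc, PointBlowup.translate_finset_sum, coeff_sum] at h
    obtain ⟨d, hd, hne⟩ := Finset.exists_ne_zero_of_sum_ne_zero h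
    have hdu : ∀ u ∈ Sᶜ, ν u = d u := fun u hu => by
      have huS : u ∉ S := Finset.mem_compl.mp hu
      have huj : u ≠ j := fun h => huS (h ▸ hj)
      rw [PointBlowup.apply_eq_of_coeff_translate_monomial_ne_zero b (hbN u huS) hne,
        chartExponent_apply_of_ne' p S huj]
    have hsum : ∑ u ∈ Sᶜ, ν u = ∑ u ∈ Sᶜ, d u := Finset.sum_congr rfl hdu
    have h1 : degIn S d + ∑ u ∈ Sᶜ, d u = d.degree := degIn_add_sum_compl S d
    have h2 : degIn S d = k := hinit d (hmemT d hd).1 (hmemT d hd).2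
    have h3 : d.degree = o := (hmemT d hd).2
    omega
  -- the rest does not contribute at `ν`
  have hzero : coeff ν (PointBlowup.translate b Pr) = 0 := by
    rw [hPr, PointBlowup.translate_finset_sum, coeff_sum]
    refine Finset.sum_eq_zero fun d hd => ?_
    obtain ⟨hdF, hdo⟩ := Finset.mem_filter.mp hd
    by_contra hne
    have hjeq := PointBlowup.apply_eq_of_coeff_translate_monomial_ne_zero b hbj hne
    rw [chartExponent_apply_self', hνj, hρj] at hjeq
    have hk : degIn S d = k := by
      have := hdegIn d hdF
      omega
    have hdu : ∀ u ∈ Sᶜ, ν u = d u := fun u hu => by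
      have huS : u ∉ S := Finset.mem_compl.mp hu
      have huj : u ≠ j := fun h => huS (h ▸ hj)
      rw [PointBlowup.apply_eq_of_coeff_translate_monomial_ne_zero b (hbN u huS) hne,
        chartExponent_apply_of_ne' p S huj]
    have hsum : ∑ u ∈ Sᶜ, ν u = ∑ u ∈ Sᶜ, d u := Finset.sum_congr rfl hdu
    have h1 : degIn S d + ∑ u ∈ Sᶜ, d u = d.degree := degIn_add_sum_compl S d
    have h2 : o ≤ d.degree := hdeg d hdF
    apply hdo
    omega
  have htadd : PointBlowup.translate b (Pc + Pr) =
      PointBlowup.translate b Pc + PointBlowup.translate b Pr := by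
    unfold PointBlowup.translate
    rw [map_add]
  rw [hsplit, htadd, coeff_add, hzero, add_zero]
  exact MvPolynomial.mem_support_iff.mp hν

end LowMonomial

/-! ### 3. Reading `ω(x')` off a low monomial of the transform -/

section Reading

variable {σ : Type*} {K : Type*} [Field K] [Fintype σ] [DecidableEq σ] [DecidableEq K]
variable (p : ℕ) [hp : Fact p.Prime] [CharP K p]

omit [Fintype σ] [DecidableEq K] hp [CharP K p] in
/-- A monomial with an exponent prime to `p` survives the cleaning. [folklore] -/
private theorem coeff_deletePthPowers_of_not_dvd' (G : MvPolynomial σ K) {e : σ →₀ ℕ} {i : σ}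
    (hi : ¬ p ∣ e i) : coeff e (deletePthPowers p G) = coeff e G := by
  rw [coeff_deletePthPowers, if_neg]
  intro h
  exact hi ((isPthPowerExponent_iff p e).mp h i)

omit [Fintype σ] [DecidableEq K] hp [CharP K p] in
/-- **`ord₀ F' ≤ |r'| + m` gives `ω(x') ≤ m`**: a monomial of the transform `G`, surviving the cleaning,
of degree `≤ |r'| + m`, where `ε(x') ≤ ord₀ F' − |r'|`. [folklore] -/
private theorem omega_le_of_low_monomial' (s' : CState σ K) (G : MvPolynomial σ K)
    (hF' : s'.F = deletePthPowers p G) (R : ℕ) (hε : s'.epsilon ≤ ordZero s'.F - (R : ℕ∞))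
    {e : σ →₀ ℕ} (he : coeff e G ≠ 0) {i : σ} (hi : ¬ p ∣ e i) {m : ℕ} (hdeg : e.degree ≤ R + m) :
    s'.omega ≤ (m : ℕ∞) := by
  have he' : coeff e s'.F ≠ 0 := by rwa [hF', coeff_deletePthPowers_of_not_dvd' p G hi]
  have ho : ordZero s'.F ≤ (e.degree : ℕ∞) := ordZero_le_of_coeff_ne_zero _ e he'
  calc s'.omega ≤ s'.epsilon := CState.omega_le_epsilon s'
    _ ≤ ordZero s'.F - (R : ℕ∞) := hε
    _ ≤ (e.degree : ℕ∞) - (R : ℕ∞) := tsub_le_tsub_right ho _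
    _ ≤ (m : ℕ∞) := by
        rw [← ENat.coe_sub]
        exact_mod_cast (by omega : e.degree - R ≤ m)

omit [Fintype σ] [DecidableEq K] hp in
/-- **A `V`-witness of `F'` in degree `≤ |r'| + m + 1` gives `ω(x') ≤ m`**: a monomial of `G` with an
exponent prime to `p` at a variable `t ∉ E'`, of degree `≤ |r'| + m + 1`; either it is initial in `F'`
(then `V(F'_{p,Z'},E') ≠ 0` and `ω(x') = ε(x') − 1`) or `ord₀ F'` is smaller. [folklore] -/
private theorem omega_le_of_low_witness' (s' : CState σ K) (G : MvPolynomial σ K)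
    (hF' : s'.F = deletePthPowers p G) (R : ℕ) (hε : s'.epsilon ≤ ordZero s'.F - (R : ℕ∞))
    {e : σ →₀ ℕ} (he : coeff e G ≠ 0) {t : σ} (ht : t ∉ s'.exc) (hpt : ¬ p ∣ e t) {m : ℕ}
    (hdeg : e.degree ≤ R + m + 1) : s'.omega ≤ (m : ℕ∞) := by
  have he' : coeff e s'.F ≠ 0 := by rwa [hF', coeff_deletePthPowers_of_not_dvd' p G hpt]
  have hF0 : s'.F ≠ 0 := MvPolynomial.ne_zero_iff.mpr ⟨e, he'⟩
  obtain ⟨o', ho'⟩ := exists_ordZero_eq' hF0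
  have hole : o' ≤ e.degree := by
    have := ordZero_le_of_coeff_ne_zero _ e he'
    rw [ho'] at this
    exact_mod_cast this
  rcases hole.lt_or_eq with hlt | heq
  · -- `ord₀ F' ≤ |e| − 1 ≤ R + m`
    calc s'.omega ≤ s'.epsilon := CState.omega_le_epsilon s'
      _ ≤ ordZero s'.F - (R : ℕ∞) := hε
      _ ≤ (m : ℕ∞) := by
          rw [ho', ← ENat.coe_sub]
          exact_mod_cast (by omega : o' - R ≤ m)
  · -- `y^e` is an initial monomial of `F'` with `p ∤ e_t`, `t ∉ E'`: `V ≠ 0`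
    have het : 1 ≤ e t := Nat.one_le_iff_ne_zero.mpr fun h => hpt (h ▸ dvd_zero p)
    have hV : PointBlowup.VNonzero s'.exc s'.F := by
      refine ⟨t, ht, MvPolynomial.ne_zero_iff.mpr ⟨e - Finsupp.single t 1, ?_⟩⟩
      have hsub : e - Finsupp.single t 1 + Finsupp.single t 1 = e :=
        tsub_add_cancel_of_le (Finsupp.single_le_iff.mpr (by simpa using het))
      rw [coeff_pderiv, hsub]
      have hinit : coeff e (initialForm s'.F) = coeff e s'.F := by
        unfold HauserPerlega2019.initialForm
        rw [coeff_homogeneousComponent, if_pos]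
        rw [ho', heq]
        rfl
      rw [hinit]
      refine mul_ne_zero he' ?_
      have hcast : (((e - Finsupp.single t 1 : σ →₀ ℕ) t : ℕ) : K) + 1 = ((e t : ℕ) : K) := by
        rw [← Nat.cast_succ]
        congr 1
        rw [Finsupp.tsub_apply, Finsupp.single_eq_same]
        omega
      rw [hcast, Ne, CharP.cast_eq_zero_iff K p]
      exact hpt
    rw [CState.omega_eq_of_vNonzero s' hV]
    refine tsub_le_iff_right.mpr ?_
    calc s'.epsilon ≤ ordZero s'.F - (R : ℕ∞) := hε
      _ ≤ ((m + 1 : ℕ) : ℕ∞) := by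
          rw [ho', ← ENat.coe_sub]
          exact_mod_cast (by omega : o' - R ≤ m + 1)
      _ = (m : ℕ∞) + 1 := Nat.cast_add_one m

omit [Fintype σ] hp in
/-- **Landing.** A monomial `y^ν` of degree `≤ |r'| + m` of `U_j ∂G/∂U_j`, or of `(U_i + b_i)∂G/∂U_i`
for some `i ≠ j`, gives `ω(x') ≤ m`: it is a monomial of `G` with `p ∤ ν_j` (resp. `p ∤ ν_i`), or —
only when `b_i ≠ 0`, so that `U_i` is not a component of `E'` — `y^{ν + e_i}` is a monomial of `G` with
`p ∤ ν_i + 1`. [folklore] -/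
private theorem omega_le_of_landing' (S : Finset σ) (j : σ) (b : σ → K) (s : CState σ K) (R : ℕ)
    (hε : (step p S j b s).epsilon ≤ ordZero (step p S j b s).F - (R : ℕ∞)) {ν : σ →₀ ℕ} {m : ℕ}
    (hν : ν.degree ≤ R + m)
    (h : coeff ν (X j * pderiv j (pointTransform p S j b s)) ≠ 0 ∨
      ∃ i, i ≠ j ∧ coeff ν ((X i + C (b i)) * pderiv i (pointTransform p S j b s)) ≠ 0) :
    (step p S j b s).omega ≤ (m : ℕ∞) := by
  set G := pointTransform p S j b s with hG
  have hF' : (step p S j b s).F = deletePthPowers p G := rfl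
  have key : ∀ i, coeff ν G ≠ 0 → (((ν i : ℕ) : K)) ≠ 0 → (step p S j b s).omega ≤ (m : ℕ∞) := by
    intro i hc hi
    have hndvd : ¬ p ∣ ν i := by rwa [Ne, CharP.cast_eq_zero_iff K p] at hi
    exact omega_le_of_low_monomial' p _ G hF' R hε hc hndvd hν
  rcases h with h | ⟨i, hij, h⟩
  · rw [PointBlowup.coeff_X_mul_pderiv] at h
    exact key j (right_ne_zero_of_mul h) (left_ne_zero_of_mul h)
  · rw [add_mul, coeff_add, PointBlowup.coeff_X_mul_pderiv, coeff_C_mul, coeff_pderiv] at h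
    by_cases h1 : ((ν i : ℕ) : K) * coeff ν G = 0
    · rw [h1, zero_add] at h
      have hbi : b i ≠ 0 := left_ne_zero_of_mul h
      have h2 := right_ne_zero_of_mul h
      have hc : coeff (ν + Finsupp.single i 1) G ≠ 0 := left_ne_zero_of_mul h2
      have hk : ((ν i : ℕ) : K) + 1 ≠ 0 := right_ne_zero_of_mul h2
      have hndvd : ¬ p ∣ (ν + Finsupp.single i 1 : σ →₀ ℕ) i := by
        rw [Finsupp.add_apply, Finsupp.single_eq_same, ← CharP.cast_eq_zero_iff K p, Nat.cast_succ]
        exact hk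
      have hiE : i ∉ (step p S j b s).exc := by
        show i ∉ newExc j b s
        unfold newExc
        rw [Finset.mem_insert, Finset.mem_filter, not_or]
        exact ⟨hij, fun h => hbi h.2⟩
      refine omega_le_of_low_witness' p _ G hF' R hε hc hiE hndvd ?_
      rw [map_add, Finsupp.degree_single]
      omega
    · exact key i (right_ne_zero_of_mul h1) (left_ne_zero_of_mul h1)

end Reading

/-! ### 4. The first-kind bookkeeping and the main estimate -/

section Main

variable {σ : Type*} {K : Type*} [Field K] [Fintype σ] [DecidableEq σ] [DecidableEq K]
variable (p : ℕ) [hp : Fact p.Prime] [CharP K p]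

omit [DecidableEq K] hp [CharP K p] in
/-- The numbers at a first-kind centre with `ord₀ F = o`, in `ℕ`: with `H = H|_exc` and
`k := deg_S H + (o − |H|)` one has `q ≤ k ≤ deg_S d`, `H ≤ d`, `|d| ≥ o` for every monomial `y^d` of
`F`, `deg_S d = k` for the initial ones, `|H| ≤ o`, and `H_i = 0` off `exc`.
[cite: CossartPiltant2019, Def. 3.1 and Prop. 3.1 (p. 31)] -/
private theorem firstKind_bookkeeping' {q : ℕ} {S : Finset σ} {s : CState σ K}
    (h1 : IsFirstKind q S s) {o : ℕ} (ho : ordZero s.F = o) :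
    q ≤ degIn S (PointBlowup.bigHVec s.exc s.F) + (o - (PointBlowup.bigHVec s.exc s.F).degree) ∧
    (∀ d ∈ s.F.support, degIn S (PointBlowup.bigHVec s.exc s.F) +
        (o - (PointBlowup.bigHVec s.exc s.F).degree) ≤ degIn S d) ∧
    (∀ d ∈ s.F.support, PointBlowup.bigHVec s.exc s.F ≤ d) ∧
    (∀ d ∈ s.F.support, o ≤ d.degree) ∧
    (∀ d ∈ s.F.support, d.degree = o → degIn S d = degIn S (PointBlowup.bigHVec s.exc s.F) +
        (o - (PointBlowup.bigHVec s.exc s.F).degree)) ∧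
    (PointBlowup.bigHVec s.exc s.F).degree ≤ o ∧
    (∀ i, i ∉ s.exc → PointBlowup.bigHVec s.exc s.F i = 0) := by
  obtain ⟨⟨-, hqord⟩, hii⟩ := h1
  have hF : s.F ≠ 0 := ne_zero_of_ordZero_eq' ho
  set Hv := PointBlowup.bigHVec s.exc s.F with hHv
  have hr : ∀ d ∈ s.F.support, Hv ≤ d := bigHVec_le' s.exc s.F
  have hne : s.F.support.Nonempty := MvPolynomial.support_nonempty.mpr hF
  obtain ⟨d₀, hd₀, hdeg⟩ :=
    Finset.exists_mem_eq_inf s.F.support hne (fun d : σ →₀ ℕ => (degIn S d : ℕ∞))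
  have hoS : ordAlong S s.F = (degIn S d₀ : ℕ∞) := hdeg
  have hmin : ∀ d ∈ s.F.support, degIn S d₀ ≤ degIn S d := fun d hd => by
    have h : ordAlong S s.F ≤ (degIn S d : ℕ∞) := Finset.inf_le hd
    rw [hoS] at h
    exact_mod_cast h
  obtain ⟨⟨d₁, hd₁, hdeg₁⟩, hlow⟩ := (ordZero_eq_nat_iff s.F o).mp ho
  have hd₁' : d₁ ∈ s.F.support := MvPolynomial.mem_support_iff.mpr hd₁
  have hodeg : ∀ d ∈ s.F.support, o ≤ d.degree := fun d hd => by
    by_contra hlt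
    exact (MvPolynomial.mem_support_iff.mp hd) (hlow d (not_le.mp hlt))
  have hB : Hv.degree ≤ o := le_of_le_of_eq (PointBlowup.degree_le_degree_of_le (hr d₁ hd₁')) hdeg₁
  -- `ε(y) = ε(x)` in `ℕ`
  have hdegInHv : degIn S Hv = ∑ i ∈ S ∩ s.exc, Hv i := by
    unfold degIn
    exact (Finset.sum_subset Finset.inter_subset_left fun i hiS hi => by
      rw [hHv, bigHVec_apply', if_neg (fun hiE => hi (Finset.mem_inter.mpr ⟨hiS, hiE⟩))]).symm
  have hsumE : ∀ E : Finset σ, E ⊆ s.exc →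
      ∑ i ∈ E, PointBlowup.bigH s.F i = ((∑ i ∈ E, Hv i : ℕ) : ℕ∞) := fun E hE => by
    rw [Nat.cast_sum]
    refine Finset.sum_congr rfl fun i hi => ?_
    rw [bigH_eq_toNat' hF i, hHv, bigHVec_apply', if_pos (hE hi)]
  have hnat : degIn S d₀ - ∑ i ∈ S ∩ s.exc, Hv i = o - Hv.degree := by
    have h := hii
    unfold epsilonAlong at h
    rw [CState.epsilon_eq, hoS, ho, hsumE _ Finset.inter_subset_right, sum_bigH_eq' hF,
      ← ENat.coe_sub, ← ENat.coe_sub] at h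
    exact_mod_cast h
  have hA : ∑ i ∈ S ∩ s.exc, Hv i ≤ degIn S d₀ := by
    rw [← hdegInHv]
    exact degIn_le_degIn_of_le S (hr d₀ hd₀)
  have hk : degIn S Hv + (o - Hv.degree) = degIn S d₀ := by
    rw [hdegInHv]
    omega
  have hq0 : q ≤ degIn S d₀ := by
    rw [hoS] at hqord
    exact_mod_cast hqord
  refine ⟨hk ▸ hq0, fun d hd => hk ▸ hmin d hd, hr, hodeg, ?_, hB, ?_⟩
  · intro d hd hdo
    refine le_antisymm ?_ (hk ▸ hmin d hd)
    -- `deg_S d = o − Σ_{u∉S} d_u ≤ o − Σ_{u∉S} H_u = k`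
    have h1 := degIn_add_sum_compl S d
    have h2 := degIn_add_sum_compl S Hv
    have h3 : ∑ u ∈ Sᶜ, Hv u ≤ ∑ u ∈ Sᶜ, d u :=
      Finset.sum_le_sum fun u _ => Finsupp.le_def.mp (hr d hd) u
    omega
  · intro i hi
    rw [hHv, bigHVec_apply', if_neg hi]

omit hp [CharP K p] in
/-- After the `C_S`-step, `ε(x')` is dominated by the shade of the step of the auxiliary Moh state
`(F, H|_exc, exc)`: `ε(x') ≤ ord₀ F' − |r'|`. [folklore] -/
private theorem epsilon_step_le_sub' (q : ℕ) (S : Finset σ) (j : σ) (b : σ → K)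
    (hbj : b j = 0) (s : CState σ K) {o : ℕ} (ho : ordZero s.F = o)
    (hperm : ∀ d ∈ s.F.support, degIn S (PointBlowup.bigHVec s.exc s.F) +
      (o - (PointBlowup.bigHVec s.exc s.F).degree) ≤ degIn S d) :
    (step q S j b s).epsilon ≤ ordZero (step q S j b s).F -
      (((step q S j b ⟨s.F, PointBlowup.bigHVec s.exc s.F, s.exc⟩).r.degree : ℕ) : ℕ∞) := by
  set t : CState σ K := ⟨s.F, PointBlowup.bigHVec s.exc s.F, s.exc⟩ with ht
  have hF' : (step q S j b t).F = (step q S j b s).F := rfl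
  have hr : ∀ d ∈ t.F.support, t.r ≤ d := bigHVec_le' s.exc s.F
  have hρ : ∀ e ∈ (step q S j b t).F.support, (step q S j b t).r ≤ e :=
    newMult_le_of_mem_support_step q S j b hbj t ho hr hperm
  have hρeq : (step q S j b t).r =
      (t.r.update j (degIn S t.r + (o - t.r.degree) - q)).filter (fun i => b i = 0) :=
    step_r_eq q S j b hbj t ho hr hperm
  have hsub : ∀ i, (step q S j b t).r i ≠ 0 → i ∈ (step q S j b s).exc := by
    intro i hi
    rw [hρeq, Finsupp.filter_apply] at hi
    show i ∈ insert j (s.exc.filter fun i => b i = 0)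
    rw [mem_insert, mem_filter]
    by_cases hij : i = j
    · exact Or.inl hij
    · right
      split_ifs at hi with hb
      · rw [Finsupp.update_apply, if_neg hij] at hi
        have hiE : i ∈ s.exc := by
          by_contra hiE
          apply hi
          show PointBlowup.bigHVec s.exc s.F i = 0
          rw [bigHVec_apply', if_neg hiE]
        exact ⟨hiE, hb⟩
      · exact absurd rfl hi
  have h1 : (((step q S j b t).r.degree : ℕ) : ℕ∞) ≤
      ∑ i ∈ (step q S j b s).exc, PointBlowup.bigH (step q S j b s).F i :=
    calc (((step q S j b t).r.degree : ℕ) : ℕ∞)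
        = ∑ i ∈ (step q S j b t).r.support, (((step q S j b t).r i : ℕ) : ℕ∞) := by
          rw [Finsupp.degree_apply, Nat.cast_sum]
      _ ≤ ∑ i ∈ (step q S j b s).exc, (((step q S j b t).r i : ℕ) : ℕ∞) :=
          Finset.sum_le_sum_of_subset_of_nonneg
            (fun i hi => hsub i (Finsupp.mem_support_iff.mp hi)) (fun _ _ _ => zero_le)
      _ ≤ ∑ i ∈ (step q S j b s).exc, PointBlowup.bigH (step q S j b s).F i :=
          Finset.sum_le_sum fun i _ =>
            Finset.le_inf fun e he => by
              exact_mod_cast Finsupp.le_def.mp (hρ e (hF' ▸ he)) i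
  rw [CState.epsilon_eq]
  exact tsub_le_tsub_left h1 _

omit hp in
/-- **The main estimate.**  At a first-kind centre with `ord₀ F = o`, let `y^{d₀}` be an initial monomial
with `p ∤ (d₀)_l`.  Then `ω(x') ≤ ε(x) − δ` for `δ = 0`, and for `δ = 1` provided `l ∉ exc` (a
`V`-witness).  [cite: CossartPiltant2019, Thm. 3.6 (p. 35), proof pp. 36–38] -/
private theorem omega_step_le_core' {S : Finset σ} {j : σ} (hj : j ∈ S) (b : σ → K) (hbj : b j = 0)
    (hbN : ∀ i, i ∉ S → b i = 0) (s : CState σ K) (h1 : IsFirstKind p S s) {o : ℕ}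
    (ho : ordZero s.F = o) {l : σ} {d₀ : σ →₀ ℕ} (hd₀ : d₀ ∈ s.F.support) (hd₀o : d₀.degree = o)
    (hl : ¬ p ∣ d₀ l) {δ : ℕ} (hδ : δ ≤ 1) (hδl : δ = 1 → l ∉ s.exc) :
    (step p S j b s).omega ≤ ((o - (PointBlowup.bigHVec s.exc s.F).degree - δ : ℕ) : ℕ∞) := by
  obtain ⟨hpk, hdegIn, hr, hdeg, hinit, hHo, hHoff⟩ := firstKind_bookkeeping' h1 ho
  set Hv := PointBlowup.bigHVec s.exc s.F with hHv
  set k := degIn S Hv + (o - Hv.degree) with hk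
  set εn := o - Hv.degree with hεn
  have hq : ∀ d ∈ s.F.support, p ≤ degIn S d := fun d hd => le_trans hpk (hdegIn d hd)
  -- the new record `R` of the auxiliary state and `ε(x') ≤ ord₀ F' − |R|`
  set t : CState σ K := ⟨s.F, Hv, s.exc⟩ with ht
  have hRdef : (step p S j b t).r = (Hv.update j (k - p)).filter (fun i => b i = 0) :=
    step_r_eq p S j b hbj t ho hr hdegIn
  set R := (step p S j b t).r with hR
  have hε := epsilon_step_le_sub' p S j b hbj s ho hdegIn
  rw [← ht, ← hR] at hε
  set ρ₀ : σ →₀ ℕ := Hv.update j (k - p) with hρ₀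
  have hρ₀R : (ρ₀.filter fun i => b i = 0).degree = R.degree := by rw [hRdef]
  have hρ₀deg : ρ₀.degree + Hv j = Hv.degree + (k - p) := PointBlowup.degree_update_add Hv j (k - p)
  have hρ₀j : ρ₀ j = k - p := by rw [hρ₀, Finsupp.update_apply, if_pos rfl]
  have hρ₀i : ∀ i, i ≠ j → ρ₀ i = Hv i := fun i hi => by rw [hρ₀, Finsupp.update_apply, if_neg hi]
  -- the witness `d₀`: `H_l + δ ≤ (d₀)_l`, hence `δ ≤ εn`
  have hd₀l : 1 ≤ d₀ l := Nat.one_le_iff_ne_zero.mpr fun h => hl (h ▸ dvd_zero p)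
  have hHlδ : ∀ d ∈ s.F.support, (((d l : ℕ) : K)) ≠ 0 → Hv l + δ ≤ d l := by
    intro d hd hdl
    have h1 : 1 ≤ d l := Nat.one_le_iff_ne_zero.mpr fun h => hdl (by rw [h, Nat.cast_zero])
    rcases Nat.le_one_iff_eq_zero_or_eq_one.mp hδ with h0 | h1'
    · rw [h0, add_zero]; exact Finsupp.le_def.mp (hr d hd) l
    · rw [h1', hHoff l (hδl h1')]; omega
  have hδε : δ ≤ εn := by
    rcases Nat.le_one_iff_eq_zero_or_eq_one.mp hδ with h0 | h1'
    · rw [h0]; exact Nat.zero_le _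
    · have hlt : Hv < d₀ := by
        refine lt_of_le_of_ne (hr d₀ hd₀) fun h => ?_
        have := hHoff l (hδl h1')
        rw [h] at this
        omega
      have := PointBlowup.degree_lt_degree_of_lt hlt
      rw [hd₀o] at this
      rw [h1']
      omega
  have hcastl : ∀ d : σ →₀ ℕ, ¬ p ∣ d l → (((d l : ℕ) : K)) ≠ 0 := fun d hd => by
    rwa [Ne, CharP.cast_eq_zero_iff K p]
  -- degrees of chart exponents of initial monomials: `|d^S| + d_j = o + (k − p)`
  have hcEdeg : ∀ d ∈ s.F.support, d.degree = o →
      (chartExponent p S j d).degree + d j = o + (k - p) := fun d hd hdo => by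
    rw [degree_chartExponent_add', hinit d hd hdo, hdo]
  have hcEj : ∀ d ∈ s.F.support, d.degree = o → chartExponent p S j d j = k - p := fun d hd hdo => by
    rw [chartExponent_apply_self', hinit d hd hdo]
  by_cases hlj : l = j
  · -- ### the chart variable: Euler transport, weight `d_j`
    subst hlj
    have hρ : ∀ d ∈ s.F.support, d.degree = o → (((d l : ℕ) : K)) * coeff d s.F ≠ 0 →
        ρ₀ ≤ chartExponent p S l d ∧ (chartExponent p S l d).degree ≤ ρ₀.degree + (εn - δ) := by
      intro d hd hdo hw
      have hdl := hHlδ d hd (left_ne_zero_of_mul hw)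
      refine ⟨Finsupp.le_def.mpr fun i => ?_, ?_⟩
      · by_cases hil : i = l
        · rw [hil, hρ₀j, hcEj d hd hdo]
        · rw [hρ₀i i hil, chartExponent_apply_of_ne' p S hil]
          exact Finsupp.le_def.mp (hr d hd) i
      · have := hcEdeg d hd hdo
        omega
    obtain ⟨ν, hν, hνdeg⟩ := exists_low_monomial' p S hj b hbj hbN s.F hpk hdeg hdegIn hinit
      (fun d => ((d l : ℕ) : K)) ρ₀ hρ₀j (εn - δ) hρ
      ⟨d₀, hd₀, hd₀o, mul_ne_zero (hcastl d₀ hl) (MvPolynomial.mem_support_iff.mp hd₀)⟩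
    rw [transport_euler' p S hj b hbj s.F hq, coeff_sub, coeff_sum] at hν
    have hν' : coeff ν (X l * pderiv l (pointTransform p S l b s)) -
        ∑ i ∈ S.erase l, coeff ν ((X i + C (b i)) * pderiv i (pointTransform p S l b s)) ≠ 0 := hν
    rw [hρ₀R] at hνdeg
    have hm : (o - Hv.degree - δ : ℕ) = εn - δ := rfl
    rw [hm]
    refine omega_le_of_landing' p S l b s R.degree hε hνdeg ?_
    by_cases hjj : coeff ν (X l * pderiv l (pointTransform p S l b s)) ≠ 0
    · exact Or.inl hjj
    · right
      rw [not_not] at hjj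
      rw [hjj, zero_sub, neg_ne_zero] at hν'
      obtain ⟨i, hi, hne⟩ := Finset.exists_ne_zero_of_sum_ne_zero hν'
      exact ⟨i, Finset.ne_of_mem_erase hi, hne⟩
  · -- ### a variable `l ≠ j`: weight `d_l`, transport `(U_l + b_l) ∂G/∂U_l`
    set ρ : σ →₀ ℕ := ρ₀ + Finsupp.single l δ with hρdef
    have hρj : ρ j = k - p := by
      rw [hρdef, Finsupp.add_apply, hρ₀j, Finsupp.single_apply, if_neg hlj, add_zero]
    have hρ : ∀ d ∈ s.F.support, d.degree = o → (((d l : ℕ) : K)) * coeff d s.F ≠ 0 →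
        ρ ≤ chartExponent p S j d ∧ (chartExponent p S j d).degree ≤ ρ.degree + (εn - δ) := by
      intro d hd hdo hw
      have hdl := hHlδ d hd (left_ne_zero_of_mul hw)
      refine ⟨Finsupp.le_def.mpr fun i => ?_, ?_⟩
      · rw [hρdef, Finsupp.add_apply, Finsupp.single_apply]
        by_cases hij : i = j
        · rw [hij, hρ₀j, hcEj d hd hdo, if_neg hlj, add_zero]
        · rw [hρ₀i i hij, chartExponent_apply_of_ne' p S hij]
          by_cases hli : l = i
          · rw [if_pos hli, ← hli]; exact hdl
          · rw [if_neg hli, add_zero]; exact Finsupp.le_def.mp (hr d hd) i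
      · have h1 := hcEdeg d hd hdo
        have h2 : ρ.degree = ρ₀.degree + δ := by rw [hρdef, map_add, Finsupp.degree_single]
        have h3 := Finsupp.le_def.mp (hr d hd) j
        omega
    obtain ⟨ν, hν, hνdeg⟩ := exists_low_monomial' p S hj b hbj hbN s.F hpk hdeg hdegIn hinit
      (fun d => ((d l : ℕ) : K)) ρ hρj (εn - δ) hρ
      ⟨d₀, hd₀, hd₀o, mul_ne_zero (hcastl d₀ hl) (MvPolynomial.mem_support_iff.mp hd₀)⟩
    rw [← transport_log_ne' p S hlj b s.F] at hν
    have hfilt : (ρ.filter fun i => b i = 0).degree = R.degree + (if b l = 0 then δ else 0) := by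
      rw [hρdef, Finsupp.filter_add, map_add, hρ₀R]
      congr 1
      split_ifs with hbl
      · rw [Finsupp.filter_single_of_pos (fun i => b i = 0) hbl, Finsupp.degree_single]
      · rw [Finsupp.filter_single_of_neg (fun i => b i = 0) hbl, map_zero]
    rw [hfilt] at hνdeg
    have hm : (o - Hv.degree - δ : ℕ) = εn - δ := rfl
    rw [hm]
    by_cases hbl : b l = 0
    · -- untranslated: the monomial is `y^ν ∈ supp G` with `p ∤ ν_l`
      rw [if_pos hbl] at hνdeg
      rw [hbl, C_0, add_zero, PointBlowup.coeff_X_mul_pderiv] at hν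
      have hc : coeff ν (pointTransform p S j b s) ≠ 0 := right_ne_zero_of_mul hν
      have hνl : ¬ p ∣ ν l := by
        rw [← CharP.cast_eq_zero_iff K p]
        exact left_ne_zero_of_mul hν
      rcases Nat.le_one_iff_eq_zero_or_eq_one.mp hδ with h0 | h1'
      · rw [h0] at hνdeg ⊢
        rw [Nat.sub_zero]
        exact omega_le_of_low_monomial' p _ _ rfl R.degree hε hc hνl (by omega)
      · have hlE : l ∉ (step p S j b s).exc := by
          show l ∉ newExc j b s
          unfold newExc
          rw [Finset.mem_insert, Finset.mem_filter, not_or]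
          exact ⟨hlj, fun h => hδl h1' h.1⟩
        rw [h1'] at hνdeg ⊢
        exact omega_le_of_low_witness' p _ _ rfl R.degree hε hc hlE hνl (by omega)
    · -- translated (`b_l ≠ 0`, so `U_l ∉ E'`): landing
      rw [if_neg hbl, add_zero] at hνdeg
      exact omega_le_of_landing' p S j b s R.degree hε hνdeg (Or.inr ⟨l, hlj, hν⟩)

omit [Fintype σ] hp [CharP K p] in
/-- The blow-up of the zero polynomial has `ε = 0`. [folklore] -/
private theorem epsilon_step_of_F_eq_zero' (q : ℕ) (S : Finset σ) (j : σ) (b : σ → K)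
    (s : CState σ K) (hF : s.F = 0) : (step q S j b s).epsilon = 0 := by
  have h1 : (step q S j b s).F = 0 := by
    show deletePthPowers q (PointBlowup.translate b (chartTransform q S j s.F)) = 0
    unfold chartTransform PointBlowup.translate
    rw [hF, MvPolynomial.support_zero, Finset.sum_empty, map_zero, deletePthPowers_zero]
  have hj : j ∈ (step q S j b s).exc := by
    show j ∈ newExc j b s
    exact Finset.mem_insert_self _ _
  have htop : PointBlowup.bigH (0 : MvPolynomial σ K) j = ⊤ := by
    unfold PointBlowup.bigH
    rw [MvPolynomial.support_zero, Finset.inf_empty]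
  have h2 : ∑ i ∈ (step q S j b s).exc, PointBlowup.bigH (0 : MvPolynomial σ K) i = ⊤ := by
    refine eq_top_iff.mpr ?_
    calc (⊤ : ℕ∞) = PointBlowup.bigH (0 : MvPolynomial σ K) j := htop.symm
      _ ≤ ∑ i ∈ (step q S j b s).exc, PointBlowup.bigH (0 : MvPolynomial σ K) i :=
          Finset.single_le_sum (f := fun i => PointBlowup.bigH (0 : MvPolynomial σ K) i)
            (fun _ _ => zero_le) hj
  rw [CState.epsilon_eq, h1, h2]
  exact ENat.sub_top _

end Main

end CentreBlowup

/-! ### 5. The theorems -/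

namespace CentreBlowup.CState

section Omega

variable {σ : Type*} {K : Type*} [Field K] [Fintype σ] [DecidableEq σ] [DecidableEq K]
variable (p : ℕ) [hp : Fact p.Prime] [CharP K p]

omit hp in
/-- **[CP19, Thm. 3.6] `ω(x') ≤ ω(x)` under the blow-up of a permissible centre OF THE FIRST KIND, in
the model**: for a clean residual polynomial, at every point of the fibre over `x` in every chart
`j ∈ S` (no use of `ω(x) > 0`, of the equimultiplicity of `x'`, or of condition (E)).
[cite: CossartPiltant2019, Thm. 3.6 (p. 35)] -/
theorem omega_step_le_of_isFirstKind {S : Finset σ} {j : σ} (hj : j ∈ S) (b : σ → K)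
    (hbj : b j = 0) (hbN : ∀ i, i ∉ S → b i = 0) (s : CState σ K)
    (hclean : deletePthPowers p s.F = s.F) (h1 : IsFirstKind p S s) :
    (step p S j b s).omega ≤ s.omega := by
  by_cases hF : s.F = 0
  · calc (step p S j b s).omega ≤ (step p S j b s).epsilon := omega_le_epsilon _
      _ = 0 := epsilon_step_of_F_eq_zero' p S j b s hF
      _ ≤ s.omega := zero_le
  obtain ⟨o, ho⟩ := exists_ordZero_eq' hF
  have hε : s.epsilon = ((o - (PointBlowup.bigHVec s.exc s.F).degree : ℕ) : ℕ∞) :=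
    epsilon_eq_natCast' s ho
  by_cases hV : PointBlowup.VNonzero s.exc s.F
  · -- `ω(x) = ε(x) − 1`, a `V`-witness on the centre
    obtain ⟨t, -, htE, hpd⟩ := vNonzero_witness_mem_of_isFirstKind h1 hV
    obtain ⟨d₀, hd₀, hd₀o, hnd⟩ := PointBlowup.exists_not_dvd_of_pderiv_initialForm_ne_zero p ho hpd
    have hcore := omega_step_le_core' p hj b hbj hbN s h1 ho hd₀ hd₀o hnd (δ := 1) le_rfl
      (fun _ => htE)
    rw [omega_eq_of_vNonzero s hV, hε]
    calc (step p S j b s).omega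
        ≤ ((o - (PointBlowup.bigHVec s.exc s.F).degree - 1 : ℕ) : ℕ∞) := hcore
      _ = ((o - (PointBlowup.bigHVec s.exc s.F).degree : ℕ) : ℕ∞) - 1 := by
          rw [ENat.coe_sub, Nat.cast_one]
  · -- `ω(x) = ε(x)`, a log-witness from cleanliness
    obtain ⟨⟨d₁, hd₁, hdeg₁⟩, -⟩ := (ordZero_eq_nat_iff s.F o).mp ho
    have hd₁' : d₁ ∈ s.F.support := MvPolynomial.mem_support_iff.mpr hd₁
    have hnp : ¬ IsPthPowerExponent p d₁ := PointBlowup.not_isPthPowerExponent_of_clean p hclean hd₁'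
    rw [isPthPowerExponent_iff] at hnp
    push Not at hnp
    obtain ⟨l, hl⟩ := hnp
    rw [omega_eq_of_not_vNonzero s hV, hε]
    have := omega_step_le_core' p hj b hbj hbN s h1 ho hd₁' hdeg₁ hl (δ := 0) (Nat.zero_le _)
      (fun h => absurd h Nat.zero_ne_one)
    simpa using this

omit hp in
/-- **No increase of `ω` under the blow-up of a permissible centre of the first kind** (clean `F`),
at every point of the fibre over `x` in every chart `j ∈ S`. [cite: CossartPiltant2019, Thm. 3.6 (p. 35)] -/
theorem not_omegaIncreases_of_isFirstKind {S : Finset σ} {j : σ} (hj : j ∈ S) (b : σ → K)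
    (hbj : b j = 0) (hbN : ∀ i, i ∉ S → b i = 0) (s : CState σ K)
    (hclean : deletePthPowers p s.F = s.F) (h1 : IsFirstKind p S s) :
    ¬ OmegaIncreases p S j b s :=
  not_lt.mpr (omega_step_le_of_isFirstKind p hj b hbj hbN s hclean h1)

/-- **No increase of `ω` under the blow-up of ANY permissible coordinate centre** (first or second
kind; clean `F`), at every point of the fibre over `x` in every chart `j ∈ S` — the second-kind half
is `SecondKind.not_omegaIncreases_of_isSecondKind`. [cite: CossartPiltant2019, Thm. 3.6 (p. 35)] -/
theorem not_omegaIncreases_of_isPermissibleCentre {S : Finset σ} {j : σ} (hj : j ∈ S) (b : σ → K)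
    (hbj : b j = 0) (hbN : ∀ i, i ∉ S → b i = 0) (s : CState σ K)
    (hclean : deletePthPowers p s.F = s.F) (hperm : IsPermissibleCentre p S s) :
    ¬ OmegaIncreases p S j b s := by
  rcases hperm with h1 | h2
  · exact not_omegaIncreases_of_isFirstKind p hj b hbj hbN s hclean h1
  · exact SecondKind.not_omegaIncreases_of_isSecondKind p hp.out.one_lt.ne' hj b hbj hbN s h2

/-- **[CP19, Thm. 3.6] "`(m(x'), ω(x')) ≤ (m(x), ω(x))`" READ AT ONE BLOW-UP OF A PERMISSIBLE COORDINATE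
CENTRE HOLDS IN THE MODEL: the atlas predicate `NoOmegaIncreaseAtCentre p S j b s` of
`CentreBlowupAdaptedOrder.lean` is a theorem for every set of centre variables `S`, every chart `j`,
every point `b` and every state `s` with clean residual polynomial** (its hypotheses
`IsEquimultiplePoint`, `0 < ω(x) < ⊤` are not used). [cite: CossartPiltant2019, Thm. 3.6 (p. 35)] -/
theorem noOmegaIncreaseAtCentre (S : Finset σ) (j : σ) (b : σ → K) (s : CState σ K)
    (hclean : deletePthPowers p s.F = s.F) : NoOmegaIncreaseAtCentre p S j b s :=
  fun hj hbj hbN hperm _ _ _ => not_omegaIncreases_of_isPermissibleCentre p hj b hbj hbN s hclean hperm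

/-- **… hence unconditionally at every state produced by a step of the walk** (a `C_{S₀}`-step cleans
its output: `deletePthPowers_step`). [cite: CossartPiltant2019, Thm. 3.6 (p. 35)] -/
theorem noOmegaIncreaseAtCentre_step (S₀ : Finset σ) (j₀ : σ) (b₀ : σ → K) (s₀ : CState σ K)
    (S : Finset σ) (j : σ) (b : σ → K) : NoOmegaIncreaseAtCentre p S j b (step p S₀ j₀ b₀ s₀) :=
  noOmegaIncreaseAtCentre p S j b _ (deletePthPowers_step p S₀ j₀ b₀ s₀)

omit hp in
/-- **The row-wise test predicate `PointBlowup.NoOmegaIncreaseAt p j b E s` of the point atlas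
(`PointBlowupAdaptedOrder.lean`, [CP19, Thm. 3.6] first clause read at one point blow-up) holds at
every point `b` of the exceptional divisor of the chart `y_j` (`b_j = 0`), for every boundary `E`, at
every `p`-fold point (`p ≤ ord₀ F`: the point is then a first-kind centre, `isFirstKind_univ`) with clean
residual polynomial** (its hypotheses `IsEquimultiplePoint`, `0 < ω(x) < ⊤` are not used).
[cite: CossartPiltant2019, Thm. 3.6 (p. 35) with Def. 3.1 (p. 31)] -/
theorem noOmegaIncreaseAt_point (j : σ) (b : σ → K) (hbj : b j = 0) (E : Finset σ)
    (s : PointBlowup.State σ K) (hord : (p : ℕ∞) ≤ ordZero s.F)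
    (hclean : deletePthPowers p s.F = s.F) : PointBlowup.NoOmegaIncreaseAt p j b E s := by
  intro _ _ _ hinc
  haveI : Nonempty σ := ⟨j⟩
  let c : CState σ K := ⟨s.F, s.r, E⟩
  have h1 : IsFirstKind p Finset.univ c := isFirstKind_univ p c hord
  have h := not_omegaIncreases_of_isFirstKind p (Finset.mem_univ j) b hbj
    (fun i hi => absurd (Finset.mem_univ i) hi) c hclean h1
  rw [omegaIncreases_univ_iff] at h
  exact h hinc

end Omega

end CentreBlowup.CState

end Literature.AlgebraicGeometry.Resolution

end
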